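import Summits.CriticalPhenomena.PercolationContinuityZ3.Theorems.Transplant.PlanarSkeletonFrmFromDefs
import Summits.CriticalPhenomena.PercolationContinuityZ3.Theorems.Transplant.SkelFrmFromBChoiceGeomT
import Summits.CriticalPhenomena.PercolationContinuityZ3.Theorems.Transplant.SkelFrmBChoiceGeomT
import Summits.CriticalPhenomena.PercolationContinuityZ3.Theorems.Transplant.SkelFrmFromBParamsSchedAT
import Summits.CriticalPhenomena.PercolationContinuityZ3.Theorems.Transplant.SkelFrmBParamsSchedAT
import Summits.CriticalPhenomena.PercolationContinuityZ3.Theorems.Transplant.PlanarCells2LevelsT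
import Summits.CriticalPhenomena.PercolationContinuityZ3.Theorems.Transplant.SkelFrmFromBChoiceRooms
import Summits.CriticalPhenomena.PercolationContinuityZ3.Theorems.Transplant.SkelFrmBChoiceRooms
import HarnessLib
import Summits.CriticalPhenomena.PercolationContinuityZ3.Theorems.Transplant.SkelFrmBChoiceRoomsT
/-!
# U-WAVE PORT (RULING D-U, lead g21 2026-08-26; WAVE-U-MANIFEST v3.0 row «SkelFrmBChoiceRoomsT» ↦ «SkelFrmFromBChoiceRoomsT») of the tree module
# `Transplant/SkelFrmBChoiceRoomsT` onto the carrier `PlanarSkeletonFrmFrom` (frames only, cylinders connected from width `ℓ₀` on)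

ORIGINAL TITLE: (R-40) `…T` TWIN (stmt-g21, 2026-08-23; ruling p3-g16 06:23:56Z, J18; lead g11 06:35:07Z: the choice function of record moves to `frmChoiceAllQ3T`): the twin of

builds on p205010 (kernel theorem, internal audit signed; external expert review pending) — nothing in this file uses p205010; NOTHING is claimed about the
OPEN node U `SamePDropOfSkeletonFrmFrom₁` (nor U_s / the end state).  Lane `prim-bschramm`, seat `prim-hp-8 gen 53 (U-wave port pen, family P-hp8; tool of record = p3-g26 port_u.py)`; helper file
(`--supports stmt-CriticalPhenomena-4575 --as helper`).  PORT RULES r1–r4 of RULING D-U: declaration order and proof texts are those of the original,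
byte-identical except (i) the carrier token `PlanarSkeletonFrm ↦ PlanarSkeletonFrmFrom` (binders, `namespace`/`end` lines, qualified names of twinned
declarations), (ii) carrier-FREE declarations of the original (φ-level `Skelφ…` blocks and namespace-only arithmetic residents) are NOT re-declared —
this file imports the original and `export`s the twin-free residents (POLICY T / treatment (m1)); residents whose statement mentions a twinned
constant are copied, (iii) every carrier-binding declaration keeps its explicit binder `(Φ : PlanarSkeletonFrmFrom G)` in its own signature (r2).  Docstrings and citations are the original's.  Manifest row idx 70 (level 11; flags verbatim|DEF-ROW|MIXED(m1)); filed by the hp-8 lineage under RULING M-11 (family P-hp8).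
-/

noncomputable section

open scoped Classical

namespace Summit.CriticalPhenomena.PercolationContinuityZ3.Theorems.Transplant

open Literature.Probability.Percolation Literature.Probability.LatticeModels SimpleGraph KNCells
open Literature.Barriers.CriticalPhenomena (graphBall graphBall_mono)
open BoxProdZ2 (ConcRadiiG)

/-! ## §1 The world rows over `cellGeomSG₂bT` (generic) -/

namespace Skelφ

section World

variable {V : Type} [DecidableEq V] {G : SimpleGraph V} [G.LocallyFinite] {ψ : V → Site 2} {P : PCells2T} {w₀ : V} {Λ : ConcRadiiG} {b₀ : Fin 2 → ℕ}

end World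

end Skelφ

/-! ## §2 The column vertex over the staggered centre (the (ζ″) cells, map slot `φ′`) -/

namespace PlanarSkeletonFrmFrom

namespace NegB

open SkelConc (Consts)
open Neg

section Col

variable (κ : Consts) {V : Type} [DecidableEq V] [Countable V] {G : SimpleGraph V} [G.LocallyFinite] (Φ : PlanarSkeletonFrmFrom G) (t : V)
  (p : unitInterval) (D : Skelφ.StepI.DataNS V) (g f : ℕ) (c : Fin 2 → ℕ) {φ' : V → Site 2}

/-- **THE COLUMN VERTEX OVER THE STAGGERED CENTRE**: a vertex of fine position exactly `cenS y`, inside the cube window of radius `offNT y = NrepA (cenS y) + 1` (chosen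
from `hcol_fineA_atT`). [cite: KozmaNitzan2024, §4 p. 26 ((29): columns)] -/
def colVT (κ : Consts) {V : Type} [DecidableEq V] [Countable V] {G : SimpleGraph V} [G.LocallyFinite] (Φ : PlanarSkeletonFrmFrom G) (t : V) (p : unitInterval) (D : Skelφ.StepI.DataNS V) (g : ℕ) (f : ℕ) (c : Fin 2 → ℕ) {φ' : V → Site 2} (hlip : Skelφ.Lip G φ') (hstep : Skelφ.Steps G φ') (hN : EqNumL κ Φ t p D g f) (y : Site 2) : V :=
  Classical.choose (hcol_fineA_atT κ Φ t p D g f c hlip hstep hN y (le_refl (offNT κ Φ t p D g f c y)))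

/-- The column vertex's defining facts. [folklore] -/
theorem colVT_spec (κ : Consts) {V : Type} [DecidableEq V] [Countable V] {G : SimpleGraph V} [G.LocallyFinite] (Φ : PlanarSkeletonFrmFrom G) (t : V) (p : unitInterval) (D : Skelφ.StepI.DataNS V) (g : ℕ) (f : ℕ) (c : Fin 2 → ℕ) {φ' : V → Site 2} (hlip : Skelφ.Lip G φ') (hstep : Skelφ.Steps G φ') (hN : EqNumL κ Φ t p D g f) (y : Site 2) :
    colVT κ Φ t p D g f c hlip hstep hN y ∈ Skelφ.VWin G (fineA κ Φ t p D g f φ') t ((fcellsT κ Φ t p D g f c).Q y) (offNT κ Φ t p D g f c y) ∧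
      fineA κ Φ t p D g f φ' (colVT κ Φ t p D g f c hlip hstep hN y) = (fcellsT κ Φ t p D g f c).cenS y :=
  (Classical.choose_spec (hcol_fineA_atT κ Φ t p D g f c hlip hstep hN y (le_refl (offNT κ Φ t p D g f c y))))

/-- **`fineA (colVT y) = cenS y`** (the (C)/(R) binder `hcF`). [folklore] -/
theorem colVT_eq (κ : Consts) {V : Type} [DecidableEq V] [Countable V] {G : SimpleGraph V} [G.LocallyFinite] (Φ : PlanarSkeletonFrmFrom G) (t : V) (p : unitInterval) (D : Skelφ.StepI.DataNS V) (g : ℕ) (f : ℕ) (c : Fin 2 → ℕ) {φ' : V → Site 2} (hlip : Skelφ.Lip G φ') (hstep : Skelφ.Steps G φ') (hN : EqNumL κ Φ t p D g f) (y : Site 2) :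
    fineA κ Φ t p D g f φ' (colVT κ Φ t p D g f c hlip hstep hN y) = (fcellsT κ Φ t p D g f c).cenS y :=
  (colVT_spec κ Φ t p D g f c hlip hstep hN y).2

/-- The column vertex lies in every cube window of radius `≥ offNT y`. [folklore] -/
theorem colVT_mem_VWin (κ : Consts) {V : Type} [DecidableEq V] [Countable V] {G : SimpleGraph V} [G.LocallyFinite] (Φ : PlanarSkeletonFrmFrom G) (t : V) (p : unitInterval) (D : Skelφ.StepI.DataNS V) (g : ℕ) (f : ℕ) (c : Fin 2 → ℕ) {φ' : V → Site 2} (hlip : Skelφ.Lip G φ') (hstep : Skelφ.Steps G φ') (hN : EqNumL κ Φ t p D g f) (y : Site 2) {R : ℕ}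
    (hR : offNT κ Φ t p D g f c y ≤ R) :
    colVT κ Φ t p D g f c hlip hstep hN y ∈ Skelφ.VWin G (fineA κ Φ t p D g f φ') t ((fcellsT κ Φ t p D g f c).Q y) R :=
  Skelφ.VWin_mono (subset_refl _) hR (colVT_spec κ Φ t p D g f c hlip hstep hN y).1

/-- **The column vertex lies in the cube window of the schedule of record at every anchor** (the (C)/(R) binder `hcQ`; `colQ_schedOfT`). [folklore] -/
theorem colVT_mem_VWin_schedOfT (κ : Consts) {V : Type} [DecidableEq V] [Countable V] {G : SimpleGraph V} [G.LocallyFinite] (Φ : PlanarSkeletonFrmFrom G) (t : V) (p : unitInterval) (D : Skelφ.StepI.DataNS V) (g : ℕ) (f : ℕ) (c : Fin 2 → ℕ) {φ' : V → Site 2} (hlip : Skelφ.Lip G φ') (hstep : Skelφ.Steps G φ') (hN : EqNumL κ Φ t p D g f) (S : Skelφ.Prm.SchedIn) (a : ℕ) (y : Site 2) :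
    colVT κ Φ t p D g f c hlip hstep hN y ∈
      Skelφ.VWin G (fineA κ Φ t p D g f φ') t ((fcellsT κ Φ t p D g f c).Q y) ((schedOfT κ Φ t p D g f c S).rQ a y) :=
  colVT_mem_VWin κ Φ t p D g f c hlip hstep hN y (colQ_schedOfT κ Φ t p D g f c S a y)

/-- **The column vertex's depth** `colVT y ∈ B_G(t, offNT y)`. [folklore] -/
theorem colVT_mem_graphBall (κ : Consts) {V : Type} [DecidableEq V] [Countable V] {G : SimpleGraph V} [G.LocallyFinite] (Φ : PlanarSkeletonFrmFrom G) (t : V) (p : unitInterval) (D : Skelφ.StepI.DataNS V) (g : ℕ) (f : ℕ) (c : Fin 2 → ℕ) {φ' : V → Site 2} (hlip : Skelφ.Lip G φ') (hstep : Skelφ.Steps G φ') (hN : EqNumL κ Φ t p D g f) (y : Site 2) :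
    colVT κ Φ t p D g f c hlip hstep hN y ∈ graphBall G t (offNT κ Φ t p D g f c y) :=
  Skelφ.mem_graphBall_of_mem_VWin (colVT_spec κ Φ t p D g f c hlip hstep hN y).1

/-- **THE COLUMN VERTEX'S DEPTH IS LINEAR IN THE CELL INDEX** (the (C)/(R) binder `hcD` with `cC := cOffS`, `dC := 1`; KGDepth's `D₀`):
`colVT y ∈ B_G(t, cOffS·(|y₀| + |y₁|) + 1)`, under the numeric long clause and `|h_L| ≤ 10·n_L`. [cite: KozmaNitzan2024, §4 Lemma 10 Step IV (pp. 20–21)] -/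
theorem colVT_mem_graphBall_lin (κ : Consts) {V : Type} [DecidableEq V] [Countable V] {G : SimpleGraph V} [G.LocallyFinite] (Φ : PlanarSkeletonFrmFrom G) (t : V) (p : unitInterval) (D : Skelφ.StepI.DataNS V) (g : ℕ) (f : ℕ) (c : Fin 2 → ℕ) {φ' : V → Site 2} (hlip : Skelφ.Lip G φ') (hstep : Skelφ.Steps G φ') (hN : EqNumL κ Φ t p D g f)
    (hκ : (hL κ Φ t p D g f).natAbs ≤ 10 * nL κ Φ t p D g f) (y : Site 2) :
    colVT κ Φ t p D g f c hlip hstep hN y ∈ graphBall G t (cOffS κ Φ t p D g f * ((y 0).natAbs + (y 1).natAbs) + 1) :=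
  graphBall_mono G t (offNT_le κ Φ t p D g f c hN hκ y) (colVT_mem_graphBall κ Φ t p D g f c hlip hstep hN y)

/-- **`QSepGeom` for the staggered cells at the fine map of record** (any schedule, any boxes): the (C) residue's `hQ` at `NegB.ΓQT` (with `φ′ := φL …`, `D := O.merged`,
`hN := eqNumL_of_atQT hAt`). [cite: KozmaNitzan2024, §4 p. 26 ((29))] -/
theorem qSepGeom_fineA_bT (κ : Consts) {V : Type} [DecidableEq V] [Countable V] {G : SimpleGraph V} [G.LocallyFinite] (Φ : PlanarSkeletonFrmFrom G) (t : V) (p : unitInterval) (D : Skelφ.StepI.DataNS V) (g : ℕ) (f : ℕ) (c : Fin 2 → ℕ) {φ' : V → Site 2} (hlip : Skelφ.Lip G φ') (hN : EqNumL κ Φ t p D g f) (Λ : ConcRadiiG) (b₀ : Fin 2 → ℕ) :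
    QSepGeom G (Skelφ.cellGeomSG₂bT G (fineA κ Φ t p D g f φ') (fcellsT κ Φ t p D g f c) t Λ b₀) :=
  Skelφ.qSepGeomSG₂bT _ _ _ (lip_fineA_at κ Φ t p D g f hlip hN)

end Col

end NegB

end PlanarSkeletonFrmFrom

end Summit.CriticalPhenomena.PercolationContinuityZ3.Theorems.Transplant

end
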